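import Literature.NumberTheory.CubicFields.PeriodicChainCells
import Mathlib.Algebra.Order.Floor.Ring
import Mathlib.Algebra.Order.Round
import Mathlib.Data.Finset.Max
import Mathlib.Algebra.BigOperators.Ring.Finset
import Mathlib.Algebra.Order.BigOperators.Group.Finset
import Mathlib.Data.Finset.Sigma
import Mathlib.Order.Interval.Finset.Nat
import Mathlib.Tactic.NormNum
import HarnessLib

/-!
# Cells of a periodic chain sampled along a grid: periodicity, run-shaped fibres, few cells

Topic `Literature/NumberTheory/CubicFields`; theorem-only sequel of `PeriodicChainCells.lean` (a strictly increasing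
`G : ℤ → ℝ` with period `G (i + n₀) = G i + R`, its index function `idx`). Add LABELS `Lab : ℤ → Ω` that repeat EXACTLY with
the period (`Lab i = Lab j ↔ n₀ ∣ i − j`: the reduced ideals of an ideal class, Buchmann–Williams) and a resolution `N > 0`;
the CELL of `x` is `(Lab (idx x), ⌊(x − G (idx x)) N⌋₊)`. Sampling it on the grid `i Δ`, `Δ = R/S`, `i < S`:

* `cell_add_period`, `cell_add_int_mul_period` — the cell function is `R`-periodic;
* `cell_eq_iff_exists_translate` — `cell x = cell x₁` iff `x` lies in an integer `R`-translate of the sub-cell interval of `x₁`;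
* `natFinset_convex_eq_Ico`, `grid_filter_Ico` — grid points in a real interval form a run `Finset.Ico b₁ b₂`;
* `cell_grid_fibre_two_runs` — **every fibre of `i ↦ cell (iΔ)` on `[0, S)` is a disjoint union of two runs** (clause (vi) of
  the class table's interface);
* `cell_grid_image_card_le` — **few cells**: the image has at most `N (R + gmax) + n₀ + 1` values, `gmax` a bound for the gaps.

Pure real-variable combinatorics; no number theory.

## References

* J. Buchmann, H. C. Williams, *On the infrastructure of the principal ideal class of an algebraic number field of unit
  rank one*, Math. Comp. 50 (1988), §3. [BuchmannWilliams1988Infrastructure]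
* S. Hallgren, *Fast quantum algorithms for computing the unit group and class group of a number field*, STOC 2005, §4.
-/

namespace Literature.NumberTheory.CubicFields

open Finset

section Runs

/-- **A finite order-convex set of naturals is a run.** [folklore] -/
theorem natFinset_convex_eq_Ico (s : Finset ℕ)
    (h : ∀ i j k, i ∈ s → k ∈ s → i ≤ j → j ≤ k → j ∈ s) : ∃ b₁ b₂, s = Finset.Ico b₁ b₂ := by
  rcases s.eq_empty_or_nonempty with rfl | hne
  · exact ⟨0, 0, by simp⟩
  · refine ⟨s.min' hne, s.max' hne + 1, ?_⟩
    ext j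
    simp only [Finset.mem_Ico]
    constructor
    · intro hj; exact ⟨Finset.min'_le s j hj, Nat.lt_succ_of_le (Finset.le_max' s j hj)⟩
    · rintro ⟨h1, h2⟩
      exact h _ _ _ (Finset.min'_mem s hne) (Finset.max'_mem s hne) h1 (Nat.le_of_lt_succ h2)

/-- **Grid points in a real interval form a run**: `{i < S : u ≤ iΔ < w}` is some `Finset.Ico b₁ b₂` (`Δ > 0`). [folklore] -/
theorem grid_filter_Ico (S : ℕ) {Δ : ℝ} (hΔ : 0 < Δ) (u w : ℝ) :
    ∃ b₁ b₂, (Finset.range S).filter (fun i : ℕ => u ≤ i * Δ ∧ i * Δ < w) = Finset.Ico b₁ b₂ := by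
  apply natFinset_convex_eq_Ico
  intro i j k hi hk hij hjk
  simp only [Finset.mem_filter, Finset.mem_range] at hi hk ⊢
  have h1 : (i : ℝ) ≤ j := by exact_mod_cast hij
  have h2 : (j : ℝ) ≤ k := by exact_mod_cast hjk
  refine ⟨by omega, ?_, ?_⟩ <;> nlinarith [hi.2.1, hk.2.2]

end Runs

section Cells

variable {G : ℤ → ℝ} (hG : StrictMono G) {n₀ : ℕ} (hn₀ : 0 < n₀) {R : ℝ} (hper : ∀ i, G (i + n₀) = G i + R)
variable {idx : ℝ → ℤ} (hidx : ∀ x, G (idx x) ≤ x ∧ x < G (idx x + 1))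
variable {Ω : Type*} {Lab : ℤ → Ω} (hLab : ∀ i j, Lab i = Lab j ↔ (n₀ : ℤ) ∣ i - j) {N : ℝ} (hN : 0 < N)

include hG hper hidx hLab in
/-- **The cell function is `R`-periodic.** [cite: BuchmannWilliams1988Infrastructure, §3] -/
theorem cell_add_period (x : ℝ) :
    (Lab (idx (x + R)), ⌊(x + R - G (idx (x + R))) * N⌋₊) = (Lab (idx x), ⌊(x - G (idx x)) * N⌋₊) := by
  rw [chain_floor_add_period hG hper hidx, Prod.mk.injEq]
  refine ⟨(hLab _ _).2 ?_, rfl⟩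
  rw [chain_index_add_period hG hper hidx]; simp

include hG hn₀ hper hidx hLab in
/-- The cell function is invariant under all integer multiples of the period. [folklore] -/
theorem cell_add_int_mul_period (x : ℝ) (q : ℤ) :
    (Lab (idx (x + q * R)), ⌊(x + q * R - G (idx (x + q * R))) * N⌋₊) = (Lab (idx x), ⌊(x - G (idx x)) * N⌋₊) := by
  have _ := hn₀
  induction q using Int.induction_on with
  | zero => simp
  | succ q ih =>
    have e : x + (((q : ℤ) + 1 : ℤ) : ℝ) * R = (x + ((q : ℤ) : ℝ) * R) + R := by push_cast; ring
    rw [e, cell_add_period hG hper hidx hLab, ih]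
  | pred q ih =>
    have e : x + ((-(q : ℤ) : ℤ) : ℝ) * R = (x + ((-(q : ℤ) - 1 : ℤ) : ℝ) * R) + R := by push_cast; ring
    rw [e, cell_add_period hG hper hidx hLab] at ih
    exact ih

include hG hper hidx hLab hN in
/-- **When two points have the same cell**: `cell x = cell x₁` iff `x` lies in an integer `R`-translate of the sub-cell
interval `[G k₁ + m₁/N, min (G k₁ + (m₁+1)/N) (G (k₁+1)))` of `x₁` (`k₁ = idx x₁`, `m₁` its offset).
[cite: BuchmannWilliams1988Infrastructure, §3] -/
theorem cell_eq_iff_exists_translate (x₁ x : ℝ) :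
    (Lab (idx x), ⌊(x - G (idx x)) * N⌋₊) = (Lab (idx x₁), ⌊(x₁ - G (idx x₁)) * N⌋₊) ↔
      ∃ q : ℤ, G (idx x₁) + (⌊(x₁ - G (idx x₁)) * N⌋₊ : ℝ) / N + q * R ≤ x ∧
        x < G (idx x₁) + ((⌊(x₁ - G (idx x₁)) * N⌋₊ : ℝ) + 1) / N + q * R ∧ x < G (idx x₁ + 1) + q * R := by
  set k₁ := idx x₁ with hk₁
  set m₁ : ℕ := ⌊(x₁ - G k₁) * N⌋₊ with hm₁
  have hx₁ := hidx x₁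
  have hGq : ∀ q : ℤ, G (k₁ + q * n₀) = G k₁ + q * R := fun q => chain_add_mul_period hper k₁ q
  constructor
  · intro h
    rw [Prod.mk.injEq] at h
    obtain ⟨hL, hm⟩ := h
    obtain ⟨q, hq⟩ := (hLab _ _).1 hL
    have hk : idx x = k₁ + q * n₀ := by linarith
    have hx := hidx x
    rw [hk, hGq, show k₁ + q * (n₀ : ℤ) + 1 = (k₁ + 1) + q * n₀ by ring, chain_add_mul_period hper] at hx
    rw [hk, hGq] at hm
    have h0 : 0 ≤ (x - (G k₁ + q * R)) * N := mul_nonneg (by linarith [hx.1]) hN.le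
    have hfl := Nat.floor_le h0
    have hlt := Nat.lt_floor_add_one ((x - (G k₁ + q * R)) * N)
    rw [hm] at hfl hlt
    refine ⟨q, ?_, ?_, by linarith [hx.2]⟩
    · rw [← sub_nonneg]
      have : (m₁ : ℝ) / N ≤ x - (G k₁ + q * R) := by rw [div_le_iff₀ hN]; exact hfl
      linarith
    · have : x - (G k₁ + q * R) < ((m₁ : ℝ) + 1) / N := by rw [lt_div_iff₀ hN]; exact hlt
      linarith
  · rintro ⟨q, h1, h2, h3⟩
    have hm₁N : (0 : ℝ) ≤ (m₁ : ℝ) / N := by positivity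
    have hk : idx x = k₁ + q * n₀ := by
      apply chain_index_eq hG hidx
      · rw [hGq]; linarith
      · rw [show k₁ + q * (n₀ : ℤ) + 1 = (k₁ + 1) + q * n₀ by ring, chain_add_mul_period hper]; exact h3
    rw [Prod.mk.injEq]
    refine ⟨(hLab _ _).2 ⟨q, by rw [hk]; ring⟩, ?_⟩
    rw [hk, hGq]
    have h0 : 0 ≤ (x - (G k₁ + q * R)) * N := mul_nonneg (by linarith) hN.le
    rw [Nat.floor_eq_iff h0]
    constructor
    · have : (m₁ : ℝ) / N ≤ x - (G k₁ + q * R) := by linarith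
      rwa [div_le_iff₀ hN] at this
    · have : x - (G k₁ + q * R) < ((m₁ : ℝ) + 1) / N := by linarith
      rwa [lt_div_iff₀ hN] at this

include hG hn₀ hper hidx hLab hN in
/-- **Fibres of the sampled cell function are two runs.** For `S > 0` and the grid `iΔ`, `Δ = R/S`, `i < S`: every fibre of
`i ↦ cell (iΔ)` is `Finset.Ico b₁ b₂ ∪ Finset.Ico b₁' b₂'` with the two runs disjoint (a sub-cell interval has length `≤ R`,
so at most two of its `R`-translates meet `[0, R)`, in disjoint pieces). [cite: BuchmannWilliams1988Infrastructure, §3] -/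
theorem cell_grid_fibre_two_runs [DecidableEq Ω] {S : ℕ} (hS : 0 < S) (ω : Ω × ℕ) :
    ∃ b₁ b₂ b₁' b₂' : ℕ, Disjoint (Finset.Ico b₁ b₂) (Finset.Ico b₁' b₂') ∧
      (Finset.range S).filter (fun i : ℕ => (Lab (idx (i * (R / S))), ⌊(i * (R / S) - G (idx (i * (R / S)))) * N⌋₊) = ω) =
        Finset.Ico b₁ b₂ ∪ Finset.Ico b₁' b₂' := by
  have hR : 0 < R := chain_period_pos hG hn₀ hper
  have hΔ : 0 < R / S := div_pos hR (by exact_mod_cast hS)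
  set Δ : ℝ := R / S with hΔdef
  set cell : ℝ → Ω × ℕ := fun x => (Lab (idx x), ⌊(x - G (idx x)) * N⌋₊) with hcell
  by_cases hω : ∃ i₁ ∈ Finset.range S, cell (i₁ * Δ) = ω
  · obtain ⟨i₁, -, hi₁⟩ := hω
    set x₁ : ℝ := i₁ * Δ with hx₁
    set k₁ := idx x₁ with hk₁
    set m₁ : ℕ := ⌊(x₁ - G k₁) * N⌋₊ with hm₁
    -- the sub-cell interval `[a, b)` of `x₁`, of length `≤ R`
    set a : ℝ := G k₁ + (m₁ : ℝ) / N with ha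
    set b : ℝ := min (G k₁ + ((m₁ : ℝ) + 1) / N) (G (k₁ + 1)) with hb
    have hab : b - a ≤ R := by
      have h1 : b ≤ G (k₁ + 1) := min_le_right _ _
      have h2 : G (k₁ + 1) ≤ G (k₁ + n₀) := hG.monotone (by omega)
      rw [hper] at h2
      have h3 : G k₁ ≤ a := by rw [ha]; linarith [div_nonneg (Nat.cast_nonneg m₁) hN.le]
      linarith
    -- normalise `a` into `[0, R)`
    set q₀ : ℤ := -⌊a / R⌋ with hq₀
    set a' : ℝ := a + q₀ * R with ha'
    set b' : ℝ := b + q₀ * R with hb'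
    have ha'0 : 0 ≤ a' := by
      rw [ha', hq₀]
      have h := Int.floor_le (a / R)
      have : (⌊a / R⌋ : ℝ) * R ≤ a := by rwa [le_div_iff₀ hR] at h
      push_cast; linarith
    have ha'R : a' < R := by
      rw [ha', hq₀]
      have h := Int.lt_floor_add_one (a / R)
      have : a < ((⌊a / R⌋ : ℝ) + 1) * R := by rwa [div_lt_iff₀ hR] at h
      push_cast; nlinarith
    -- membership in the fibre, for points of `[0, R)`
    have key : ∀ x : ℝ, 0 ≤ x → x < R → (cell x = ω ↔ x < b' - R ∨ (a' ≤ x ∧ x < b')) := by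
      intro x hx0 hxR
      rw [← hi₁]
      change (Lab (idx x), ⌊(x - G (idx x)) * N⌋₊) = (Lab (idx x₁), ⌊(x₁ - G (idx x₁)) * N⌋₊) ↔ _
      rw [cell_eq_iff_exists_translate hG hper hidx hLab hN x₁ x]
      change (∃ q : ℤ, a + q * R ≤ x ∧ x < G k₁ + ((m₁ : ℝ) + 1) / N + q * R ∧ x < G (k₁ + 1) + q * R) ↔ _
      have hiff : ∀ q : ℤ, (a + q * R ≤ x ∧ x < G k₁ + ((m₁ : ℝ) + 1) / N + q * R ∧ x < G (k₁ + 1) + q * R) ↔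
          (a' + (q - q₀) * R ≤ x ∧ x < b' + (q - q₀) * R) := by
        intro q
        rw [ha', hb', hb]
        constructor
        · rintro ⟨h1, h2, h3⟩
          refine ⟨by linarith, ?_⟩
          rcases min_cases (G k₁ + ((m₁ : ℝ) + 1) / N) (G (k₁ + 1)) with ⟨h, -⟩ | ⟨h, -⟩ <;> rw [h] <;> linarith
        · rintro ⟨h1, h2⟩
          have hm1 := min_le_left (G k₁ + ((m₁ : ℝ) + 1) / N) (G (k₁ + 1))
          have hm2 := min_le_right (G k₁ + ((m₁ : ℝ) + 1) / N) (G (k₁ + 1))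
          exact ⟨by linarith, by linarith, by linarith⟩
      simp_rw [hiff]
      constructor
      · rintro ⟨q, h1, h2⟩
        -- only `q - q₀ ∈ {-1, 0}` is possible
        have hp1 : q - q₀ < 1 := by
          by_contra hcon
          push Not at hcon
          have : (1 : ℝ) ≤ (q - q₀ : ℤ) := by exact_mod_cast hcon
          push_cast at this h1
          nlinarith
        have hp2 : -2 < q - q₀ := by
          by_contra hcon
          push Not at hcon
          have : ((q - q₀ : ℤ) : ℝ) ≤ -2 := by exact_mod_cast hcon
          push_cast at this h2
          nlinarith
        have hcases : q - q₀ = 0 ∨ q - q₀ = -1 := by omega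
        rcases hcases with h | h
        · have h' : ((q : ℝ) - q₀) = 0 := by exact_mod_cast h
          rw [h'] at h1 h2; right; constructor <;> linarith
        · have h' : ((q : ℝ) - q₀) = -1 := by exact_mod_cast h
          rw [h'] at h1 h2; left; linarith
      · rintro (h | ⟨h1, h2⟩)
        · refine ⟨q₀ - 1, ?_, ?_⟩ <;> push_cast <;> nlinarith
        · refine ⟨q₀, ?_, ?_⟩ <;> nlinarith
    -- the two runs
    obtain ⟨b₁, b₂, hI₁⟩ := grid_filter_Ico S hΔ 0 (b' - R)
    obtain ⟨b₁', b₂', hI₂⟩ := grid_filter_Ico S hΔ a' b'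
    refine ⟨b₁, b₂, b₁', b₂', ?_, ?_⟩
    · rw [← hI₁, ← hI₂, Finset.disjoint_filter]
      rintro i - ⟨-, h1⟩ ⟨h2, -⟩
      linarith
    · rw [← hI₁, ← hI₂, ← Finset.filter_or]
      apply Finset.filter_congr
      intro i hi
      rw [Finset.mem_range] at hi
      have hi0 : (0 : ℝ) ≤ i * Δ := by positivity
      have hiR : (i : ℝ) * Δ < R := by
        have : (i : ℝ) < S := by exact_mod_cast hi
        calc (i : ℝ) * Δ < S * Δ := by nlinarith
          _ = R := by rw [hΔdef]; field_simp
      rw [key _ hi0 hiR]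
      constructor
      · rintro (h | ⟨h1, h2⟩)
        · exact Or.inl ⟨hi0, h⟩
        · exact Or.inr ⟨h1, h2⟩
      · rintro (⟨-, h⟩ | ⟨h1, h2⟩)
        · exact Or.inl h
        · exact Or.inr ⟨h1, h2⟩
  · -- empty fibre
    refine ⟨0, 0, 0, 0, by simp, ?_⟩
    rw [Finset.Ico_self, Finset.empty_union]
    apply Finset.filter_false_of_mem
    intro i hi h
    exact hω ⟨i, hi, h⟩


include hG hn₀ hper hidx hN in
/-- **Few cells**: the sampled cell function `i ↦ cell (iΔ)`, `i < S`, takes at most `N (R + gmax) + n₀ + 1` values, where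
`gmax` bounds the gaps `G (k+1) − G k` (the points of `[0, R)` have index in `[idx 0, idx 0 + n₀]`, and the cell of index `k`
has `⌈(G (k+1) − G k) N⌉ ≤ (G (k+1) − G k) N + 1` offsets). [cite: BuchmannWilliams1988Infrastructure, §3] -/
theorem cell_grid_image_card_le [DecidableEq Ω] {S : ℕ} (hS : 0 < S) {gmax : ℝ} (hgap : ∀ k, G (k + 1) - G k ≤ gmax) :
    ((((Finset.range S).image
        (fun i : ℕ => (Lab (idx (i * (R / S))), ⌊(i * (R / S) - G (idx (i * (R / S)))) * N⌋₊))).card : ℕ) : ℝ) ≤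
      N * (R + gmax) + n₀ + 1 := by
  have hR : 0 < R := chain_period_pos hG hn₀ hper
  set k₀ := idx 0 with hk₀
  set c : ℕ → ℕ := fun j => ⌈(G (k₀ + j + 1) - G (k₀ + j)) * N⌉₊ with hc
  set T : Finset (Ω × ℕ) := (Finset.range (n₀ + 1)).biUnion
    (fun j => (Finset.range (c j)).image (fun m => (Lab (k₀ + j), m))) with hT
  have hsub : (Finset.range S).image
      (fun i : ℕ => (Lab (idx (i * (R / S))), ⌊(i * (R / S) - G (idx (i * (R / S)))) * N⌋₊)) ⊆ T := by
    intro ω hω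
    rw [Finset.mem_image] at hω
    obtain ⟨i, hi, rfl⟩ := hω
    rw [Finset.mem_range] at hi
    set x : ℝ := i * (R / S) with hx
    have hx0 : 0 ≤ x := by positivity
    have hxR : x < R := by
      have : (i : ℝ) < S := by exact_mod_cast hi
      have hS' : (0 : ℝ) < S := by exact_mod_cast hS
      calc x = i * (R / S) := rfl
        _ < S * (R / S) := by apply mul_lt_mul_of_pos_right this (div_pos hR hS')
        _ = R := by field_simp
    have hk1 : k₀ ≤ idx x := chain_index_mono hG hidx hx0
    have hk2 : idx x ≤ k₀ + n₀ := by
      rw [hk₀, ← chain_index_add_period hG hper hidx, zero_add]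
      exact chain_index_mono hG hidx hxR.le
    obtain ⟨j, hj⟩ : ∃ j : ℕ, idx x = k₀ + j := ⟨(idx x - k₀).toNat, by omega⟩
    have hjn : j < n₀ + 1 := by omega
    rw [hT, Finset.mem_biUnion]
    refine ⟨j, Finset.mem_range.mpr hjn, Finset.mem_image.mpr ⟨⌊(x - G (idx x)) * N⌋₊, ?_, by rw [hj]⟩⟩
    rw [Finset.mem_range, hc]
    have hxx := hidx x
    have h0 : 0 ≤ (x - G (idx x)) * N := mul_nonneg (by linarith [hxx.1]) hN.le
    have hlt : (x - G (idx x)) * N < (G (k₀ + j + 1) - G (k₀ + j)) * N := by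
      rw [← hj]; exact mul_lt_mul_of_pos_right (by linarith [hxx.2]) hN
    have : (⌊(x - G (idx x)) * N⌋₊ : ℝ) < ⌈(G (k₀ + ↑j + 1) - G (k₀ + ↑j)) * N⌉₊ :=
      lt_of_le_of_lt (Nat.floor_le h0) (lt_of_lt_of_le hlt (Nat.le_ceil _))
    exact_mod_cast this
  have hcard : ((Finset.range S).image
      (fun i : ℕ => (Lab (idx (i * (R / S))), ⌊(i * (R / S) - G (idx (i * (R / S)))) * N⌋₊))).card ≤
      ∑ j ∈ Finset.range (n₀ + 1), c j := by
    refine (Finset.card_le_card hsub).trans ((Finset.card_biUnion_le).trans (Finset.sum_le_sum fun j _ => ?_))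
    exact Finset.card_image_le.trans (by simp)
  have hcj : ∀ j, (c j : ℝ) ≤ (G (k₀ + j + 1) - G (k₀ + j)) * N + 1 := fun j => by
    rw [hc]
    have h0 : 0 ≤ (G (k₀ + j + 1) - G (k₀ + j)) * N := mul_nonneg (by linarith [hG (show k₀ + j < k₀ + j + 1 by omega)]) hN.le
    exact (Nat.ceil_lt_add_one h0).le
  have hsum : ∑ j ∈ Finset.range (n₀ + 1), ((G (k₀ + j + 1) - G (k₀ + j)) * N + 1) =
      (G (k₀ + (n₀ + 1 : ℕ)) - G k₀) * N + (n₀ + 1) := by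
    have htel : ∑ j ∈ Finset.range (n₀ + 1), (G (k₀ + j + 1) - G (k₀ + j)) = G (k₀ + (n₀ + 1 : ℕ)) - G k₀ := by
      have h := Finset.sum_range_sub (fun j => G (k₀ + j)) (n₀ + 1)
      simp only [Nat.cast_add, Nat.cast_one, Nat.cast_zero, add_zero] at h
      rw [show (k₀ + ((n₀ + 1 : ℕ) : ℤ)) = k₀ + ((n₀ : ℤ) + 1) by push_cast; ring, ← h]
      refine Finset.sum_congr rfl fun j _ => ?_
      rw [add_assoc]
    rw [Finset.sum_add_distrib, Finset.sum_const, Finset.card_range, ← Finset.sum_mul, htel]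
    simp
  have htel : G (k₀ + (n₀ + 1 : ℕ)) - G k₀ ≤ R + gmax := by
    have h1 := hper (k₀ + 1)
    have : G (k₀ + ((n₀ + 1 : ℕ) : ℤ)) = G (k₀ + 1) + R := by rw [← h1]; congr 1; push_cast; ring
    rw [this]; linarith [hgap k₀]
  calc (((Finset.range S).image (fun i : ℕ => (Lab (idx (i * (R / S))),
          ⌊(i * (R / S) - G (idx (i * (R / S)))) * N⌋₊))).card : ℝ)
      ≤ ((∑ j ∈ Finset.range (n₀ + 1), c j : ℕ) : ℝ) := by exact_mod_cast hcard
    _ ≤ ∑ j ∈ Finset.range (n₀ + 1), ((G (k₀ + j + 1) - G (k₀ + j)) * N + 1) := by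
        push_cast; exact Finset.sum_le_sum fun j _ => hcj j
    _ = (G (k₀ + (n₀ + 1 : ℕ)) - G k₀) * N + (n₀ + 1) := hsum
    _ ≤ (R + gmax) * N + (n₀ + 1) := by nlinarith
    _ = N * (R + gmax) + n₀ + 1 := by ring

end Cells

section Summary

/-- **Summary (registered helper of the class-group stage)**: the fibres of the grid-sampled cell function of a periodic
chain with exactly periodic labels are two runs. [cite: BuchmannWilliams1988Infrastructure, §3] -/
theorem periodicChain_cell_grid_fibre_two_runs : ∀ (G : ℤ → ℝ), StrictMono G → ∀ (n₀ : ℕ), 0 < n₀ → ∀ (R : ℝ), (∀ i, G (i + n₀) = G i + R) → ∀ (idx : ℝ → ℤ), (∀ x, G (idx x) ≤ x ∧ x < G (idx x + 1)) → ∀ (Ω : Type) [DecidableEq Ω] (Lab : ℤ → Ω), (∀ i j, Lab i = Lab j ↔ (n₀ : ℤ) ∣ i - j) → ∀ (N : ℝ), 0 < N → ∀ (S : ℕ), 0 < S → ∀ (ω : Ω × ℕ), ∃ b₁ b₂ b₁' b₂' : ℕ, Disjoint (Finset.Ico b₁ b₂) (Finset.Ico b₁' b₂') ∧ (Finset.range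 S).filter (fun i : ℕ => (Lab (idx (i * (R / S))), ⌊(i * (R / S) - G (idx (i * (R / S)))) * N⌋₊) = ω) = Finset.Ico b₁ b₂ ∪ Finset.Ico b₁' b₂' :=
  fun _ hG _ hn₀ _ hper _ hidx _ _ _ hLab _ hN _ hS ω => cell_grid_fibre_two_runs hG hn₀ hper hidx hLab hN hS ω

end Summary


end Literature.NumberTheory.CubicFields
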